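import Literature.Geometry.Kaehler.ComplexTorusKernelIdealEquivalence
import HarnessLib

/-!
# Invertible ideals of `End(X)`: kernel ideals with `End(X/H(I)) = End(X)`, and `X/H(I) ≅ X ⟺ I` principal
# (Kieffer 2024 §1.4.3, the free class-group action in the proof of Theorem 2 — torus level)

For a complex torus `X = ComplexTorus Φ` (`Φ : (ι → ℝ) ≃L[ℝ] E`; `End(X) = endRingInt Φ ⊆ M_ι(ℤ)`,
`End⁰(X) = endAlgRat Φ ⊆ M_ι(ℚ)`), a left ideal `I ⊆ End(X)`, its kernel subgroup `H(I) = ⋂_{σ ∈ I} ker σ`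
(`kernelSubgroup`), the quotient torus `X/H(I)` (`quotientByPeriod`) with `η : End(X/H(I)) ↪ End⁰(X)`
(`quotientEndHom`), kernel ideals (`IsKernelIdeal`, Def. 1.4.2), the right order `O_r(I)` (`rightOrder`,
Prop. 1.4.7) and equivalence of ideals (`IdealEquiv`, Prop. 1.4.6), we formalize the FREENESS half of the
class-group action of Kieffer's Theorem 2:

> "**Theorem 2** (The CM action). Let `A` be a simple, ordinary abelian variety of dimension `g` over a finite
> field `k`. Then `F = End⁰(A) = End(A) ⊗ ℚ` is a CM field of degree `2g`, and we can simultaneously identify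
> the rings `End(B)`, where `B` runs through the `k`-isogeny class of `A`, with subrings of `F` in a compatible
> way. Let `R = End(A)`, and assume further that `R` is a maximal order or that `A` is an elliptic curve. Then
> the subset of this isogeny class consisting of abelian varieties `B` such that `End(B) = R` is a principal
> homogeneous space under the class group `Cl(R)` of `R`. […]" [Kieffer2024IsogenyGraphs, p. 2]
>
> "*Sketch of proof of Theorem 2.* When `End⁰(A)` is commutative, then we can identify endomorphism rings of
> all abelian varieties isogenous to `A` as subrings of `End⁰(A)`, simultaneously and in a compatible way.
> First, we explain why the class group of `End(A)` acts freely on abelian varieties in the isogeny class with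
> endomorphism ring `R`. Let `I` be an invertible ideal in `R`. By Proposition 1.4.7, the endomorphism ring of
> `A/H(I)` is still `R`; by Proposition 1.4.6, `A/H(I)` (up to isomorphism) does not depend on the class of
> `I` in the class group, and `A/H(I) ≃ A` if and only if `I` lies in the trivial class; and by Lemma 1.4.4, we
> indeed have a group action. On the other hand, the fact that there is only one orbit involves a careful
> analysis of lattices in Tate and (especially) Dieudonné modules, and we do not give a complete proof; see
> [Wat69, Thms. 4.5 and 7.2]." [Kieffer2024IsogenyGraphs, §1.4.3, p. 47]

Only the freeness paragraph is formalized (transitivity is not proved in the source).  The sketch applies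
Propositions 1.4.6 (2) and 1.4.7 to `I`, both of which require `I` to be a KERNEL ideal; the fact that an
invertible ideal is a kernel ideal with right order `R` — implicit in the sketch, and spelled out in the
secondary literature as "Let `I` be an invertible `S`-ideal contained in `S`. Then `I` is divisorial and hence
a kernel ideal for `A`. Also, `A/A[I]` has endomorphism ring `S`" [arXiv:2508.03570, proof of Prop. 6.10,
with Prop. 6.5 "Every divisorial ideal of `End(A)` is a kernel ideal"] — is proved here at torus level by the
GLOBAL over-lattice argument: if `x_1, …, x_n ∈ End⁰(X)` with `I x_k ⊆ End(X)` and `σ_1, …, σ_n ∈ I` satisfy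
`Σ_k x_k σ_k = 1`, then each `x_k` maps `Λ = ℤ^ι = π⁻¹(0)` into `Λ_I = π⁻¹H(I) = {y : τ_ℝ y ∈ ℤ^ι ∀ τ ∈ I}`, so
for `σ ∈ I(H(I))` every `σ x_k` is integral, i.e. `σ x_k = r_k ∈ End(X)`
(`exists_mem_idealOfSubgroup_coe_eq_mul`), and `σ = σ · Σ_k x_k σ_k = Σ_k r_k σ_k ∈ I`.

**Invertibility.**  `IsInvertibleIdeal Φ I` is "`1 ∈ I♯ · I`" with `I♯ = {x ∈ End⁰(X) : I x ⊆ End(X)}`: there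
are `x_k ∈ I♯` and `σ_k ∈ I` with `Σ_k x_k σ_k = 1`.  For commutative `End(X) = R` (the setting of Theorem 2)
this is the usual invertibility `I · (R : I) = R` of the `R`-ideal `I`; it needs no commutativity to state, and
commutativity of `End⁰(X)` is assumed below exactly where the source uses it ("the endomorphism ring of
`A/H(I)` is still `R`").

## Contents (namespace `Literature.Geometry.Kaehler.ComplexTorus`)

* §1 **`IsInvertibleIdeal Φ I`**; `isInvertibleIdeal_span_singleton` (`End(X)α` is invertible for an isogeny
  `α`, with `x = α_ℚ⁻¹`); `IsInvertibleIdeal.exists_intCast_mem` (an invertible ideal contains an isogeny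
  `[d]`, `d ∈ ℤ ∖ 0` — it is a lattice of `End(X)`), `IsInvertibleIdeal.finite_kernelSubgroup` (`H(I)` is
  finite).
* §2 **`IsInvertibleIdeal.isKernelIdeal`** (invertible ideals are kernel ideals).
* §3 **`IsInvertibleIdeal.rightOrder_eq`** (`O_r(I) = End(X)` for commutative `End⁰(X)`),
  **`IsInvertibleIdeal.range_quotientEndHom_eq`** ("By Proposition 1.4.7, the endomorphism ring of `A/H(I)`
  is still `R`": `η(End(X/H(I))) = End(X)_ℚ`), `IsInvertibleIdeal.quotientEndEquiv`
  (`End(X/H(I)) ≃+* End(X)`).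
* §4 **`IsInvertibleIdeal.isIsomorphic_quotient_iff_idealEquiv`** ("`A/H(I)` (up to isomorphism) does not
  depend on the class of `I`", and conversely: `X/H(I) ≅ X/H(J) ⟺ I ~ J`),
  **`IsInvertibleIdeal.isIsomorphic_quotient_self_iff`** ("`A/H(I) ≃ A` if and only if `I` lies in the
  trivial class": `X/H(I) ≅ X ⟺ I = End(X)α` for an isogeny `α`).  The compatibility
  `(X/H(I))/H(J^η) ≅ X/H(IJ)` making this a group action is Lemma 1.4.4
  (`isIsomorphic_quotient_idealMulEta`, `ComplexTorusIdealIsogenyComposition`).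

No named facts are introduced (one definition with body and proved theorems only).

## References

* [Kieffer2024IsogenyGraphs] J. Kieffer, *Isogeny graphs in higher dimensions* (lecture notes, 2024), Theorem 2
  (p. 2) and §1.4.3 "Sketch of proof of Theorem 2" (p. 47); §1.4.1 Def. 1.4.2, Prop. 1.4.6, Prop. 1.4.7
  (pp. 43–46); after W. C. Waterhouse, *Abelian varieties over finite fields*, Ann. Sci. ÉNS (4) 2 (1969).
* S. Marseglia et al., *Isogeny graphs of abelian varieties and singular ideals in orders* (arXiv:2508.03570),
  §6 Prop. 6.5 and proof of Prop. 6.10 (p. 15): "Let `I` be an invertible `S`-ideal contained in `S`. Then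
  `I` is divisorial and hence a kernel ideal for `A`. Also, `A/A[I]` has endomorphism ring `S` […] `Pic(S)`
  acts […] and this action is free" (secondary restatement).
-/

noncomputable section

open Module Function
open scoped Matrix

namespace Literature.Geometry.Kaehler

namespace ComplexTorus

variable {ι : Type*} [Fintype ι] [DecidableEq ι] {E : Type*} [NormedAddCommGroup E] [NormedSpace ℂ E]
  (Φ : (ι → ℝ) ≃L[ℝ] E)

/-! ## Casts (plumbing) -/

omit [Fintype ι] [DecidableEq ι] in
/-- `ℤ → ℚ → ℝ` casts of an integer matrix. [folklore] -/
private theorem map_intCast_map_ratCast_aux (A : Matrix ι ι ℤ) :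
    (A.map (Int.cast : ℤ → ℚ)).map (Rat.cast : ℚ → ℝ) = A.map (Int.cast : ℤ → ℝ) :=
  Matrix.ext fun i j ↦ Rat.cast_intCast (A i j)

omit [DecidableEq ι] in
/-- Entrywise cast `ℚ → ℝ` of a product. [folklore] -/
private theorem map_ratCast_mul_aux (A B : Matrix ι ι ℚ) :
    (A * B).map (Rat.cast : ℚ → ℝ) = A.map (Rat.cast : ℚ → ℝ) * B.map (Rat.cast : ℚ → ℝ) :=
  Matrix.map_mul (f := Rat.castHom ℝ)

omit [DecidableEq ι] in
/-- Entrywise cast `ℤ → ℚ` of a product. [folklore] -/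
private theorem map_intCast_mul_rat_aux (A B : Matrix ι ι ℤ) :
    (A * B).map (Int.cast : ℤ → ℚ) = A.map (Int.cast : ℤ → ℚ) * B.map (Int.cast : ℤ → ℚ) :=
  Matrix.map_mul (f := Int.castRingHom ℚ)

omit [Fintype ι] [DecidableEq ι] in
/-- Entrywise cast `ℤ → ℚ` of a finite sum. [folklore] -/
private theorem map_intCast_sum_aux {κ : Type*} (s : Finset κ) (M : κ → Matrix ι ι ℤ) :
    (∑ k ∈ s, M k).map (Int.cast : ℤ → ℚ) = ∑ k ∈ s, (M k).map (Int.cast : ℤ → ℚ) :=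
  map_sum ((Int.castAddHom ℚ).mapMatrix : Matrix ι ι ℤ →+ Matrix ι ι ℚ) M s

/-- `(Σ_k r_k σ_k)_ℚ = Σ_k (r_k)_ℚ (σ_k)_ℚ` in `End(X) ⊆ M_ι(ℤ) → M_ι(ℚ)`. [folklore] -/
private theorem coe_sum_mul_map_aux {κ : Type*} (s : Finset κ) (r σ : κ → endRingInt Φ) :
    ((∑ k ∈ s, r k * σ k : endRingInt Φ) : Matrix ι ι ℤ).map (Int.cast : ℤ → ℚ) =
      ∑ k ∈ s, (r k : Matrix ι ι ℤ).map (Int.cast : ℤ → ℚ) * (σ k : Matrix ι ι ℤ).map (Int.cast : ℤ → ℚ) := by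
  rw [AddSubmonoidClass.coe_finsetSum, map_intCast_sum_aux]
  exact Finset.sum_congr rfl fun k _ ↦ by rw [Subring.coe_mul, map_intCast_mul_rat_aux]

/-- Two elements of `End(X)` commute when `End⁰(X)` is commutative. [folklore] -/
private theorem mul_comm_of_endAlgRat_comm (hcomm : ∀ M ∈ endAlgRat Φ, ∀ N ∈ endAlgRat Φ, M * N = N * M)
    (α β : endRingInt Φ) : α * β = β * α :=
  Subtype.ext (Matrix.map_injective (Int.cast_injective (α := ℚ)) (by
    change ((α * β : endRingInt Φ) : Matrix ι ι ℤ).map (Int.cast : ℤ → ℚ) =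
      ((β * α : endRingInt Φ) : Matrix ι ι ℤ).map (Int.cast : ℤ → ℚ)
    rw [Subring.coe_mul, Subring.coe_mul, map_intCast_mul_rat_aux, map_intCast_mul_rat_aux]
    exact hcomm _ ((mem_endRingInt_iff Φ).1 α.2) _ ((mem_endRingInt_iff Φ).1 β.2)))

omit [DecidableEq ι] in
/-- **Clearing denominators, simultaneously**: finitely many rational matrices have a common denominator
`d ∈ ℤ ∖ 0`. [folklore] -/
private theorem exists_intMatrix_map_eq_zsmul_family {n : ℕ} (x : Fin n → Matrix ι ι ℚ) :
    ∃ d : ℤ, d ≠ 0 ∧ ∀ k, ∃ A : Matrix ι ι ℤ, A.map (Int.cast : ℤ → ℚ) = d • x k := by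
  obtain ⟨⟨d, hd⟩, h⟩ := IsLocalization.exist_integer_multiples_of_finite (nonZeroDivisors ℤ)
    fun p : Fin n × ι × ι ↦ x p.1 p.2.1 p.2.2
  choose m hm using fun p ↦ RingHom.mem_rangeS.mp (h p)
  refine ⟨d, nonZeroDivisors.ne_zero hd, fun k ↦ ⟨Matrix.of fun i j ↦ m (k, i, j), ?_⟩⟩
  ext i j
  have hij : (m (k, i, j) : ℚ) = d * x k i j := by
    rw [← zsmul_eq_mul, ← hm (k, i, j)]
    rfl
  rw [Matrix.map_apply, Matrix.of_apply, hij, Matrix.smul_apply, zsmul_eq_mul]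

/-! ## §1 Invertible ideals of `End(X)` -/

section Invertible

/-- **Invertible (left) ideals of `End(X)`.**  "Let `I` be an invertible ideal in `R`" (`R = End(A)`): there
are `x_1, …, x_n` in `I♯ = {x ∈ End⁰(X) : I x ⊆ End(X)}` and `σ_1, …, σ_n ∈ I` with `Σ_k x_k σ_k = 1`, i.e.
`1 ∈ I♯ · I`.  For commutative `R` (Kieffer's Theorem 2: `End⁰(A)` a CM field) this is the usual condition
`I · (R : I) = R` defining the invertible ideals whose classes form `Cl(R)`; an ideal `End(X)α` generated by an
isogeny is invertible (`isInvertibleIdeal_span_singleton`). [cite: Kieffer2024IsogenyGraphs, §1.4.3 (sketch of proof of Theorem 2: "Let `I` be an invertible ideal in `R`") and Theorem 2 ("the class group `Cl(R)` of `R`. Invertible `R`-ideals act as isogenies"), pp. 2, 47] -/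
def IsInvertibleIdeal (I : Ideal (endRingInt Φ)) : Prop :=
  ∃ (n : ℕ) (x : Fin n → Matrix ι ι ℚ) (σ : Fin n → endRingInt Φ),
    (∀ k, x k ∈ endAlgRat Φ) ∧
    (∀ k, ∀ τ ∈ I, ∃ r : endRingInt Φ,
      (r : Matrix ι ι ℤ).map (Int.cast : ℤ → ℚ) = (τ : Matrix ι ι ℤ).map (Int.cast : ℤ → ℚ) * x k) ∧
    (∀ k, σ k ∈ I) ∧
    ∑ k, x k * (σ k : Matrix ι ι ℤ).map (Int.cast : ℤ → ℚ) = 1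

/-- Unfolding `IsInvertibleIdeal`. [cite: Kieffer2024IsogenyGraphs, §1.4.3 (sketch of proof of Theorem 2), p. 47] -/
theorem isInvertibleIdeal_iff {I : Ideal (endRingInt Φ)} :
    IsInvertibleIdeal Φ I ↔ ∃ (n : ℕ) (x : Fin n → Matrix ι ι ℚ) (σ : Fin n → endRingInt Φ),
      (∀ k, x k ∈ endAlgRat Φ) ∧
      (∀ k, ∀ τ ∈ I, ∃ r : endRingInt Φ,
        (r : Matrix ι ι ℤ).map (Int.cast : ℤ → ℚ) = (τ : Matrix ι ι ℤ).map (Int.cast : ℤ → ℚ) * x k) ∧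
      (∀ k, σ k ∈ I) ∧
      ∑ k, x k * (σ k : Matrix ι ι ℤ).map (Int.cast : ℤ → ℚ) = 1 :=
  Iff.rfl

/-- **Principal ideals of isogenies are invertible**: for an isogeny `α ∈ End(X)` (`det α ≠ 0`), `I = End(X)α`
is invertible with `n = 1`, `x = α_ℚ⁻¹ ∈ End⁰(X)` (`(βα) α⁻¹ = β ∈ End(X)`) and `σ = α` — the trivial class of
`Cl(R)`. [cite: Kieffer2024IsogenyGraphs, §1.4.3 (sketch of proof of Theorem 2: "`A/H(I) ≃ A` if and only if `I` lies in the trivial class") and §1.4.1 ("an ideal `I` is principal if and only if it is equivalent to the trivial ideal `End(A)`"), pp. 45, 47] -/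
theorem isInvertibleIdeal_span_singleton {α : endRingInt Φ} (hα : (α : Matrix ι ι ℤ).det ≠ 0) :
    IsInvertibleIdeal Φ (Ideal.span {α}) := by
  have hαu : IsUnit ((α : Matrix ι ι ℤ).map (Int.cast : ℤ → ℚ)).det := by
    rw [← Int.cast_det]
    exact (Int.cast_ne_zero.2 hα).isUnit
  refine ⟨1, fun _ ↦ ((α : Matrix ι ι ℤ).map (Int.cast : ℤ → ℚ))⁻¹, fun _ ↦ α,
    fun _ ↦ inv_mem_endAlgRat Φ ((mem_endRingInt_iff Φ).1 α.2), fun _ τ hτ ↦ ?_,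
    fun _ ↦ Ideal.mem_span_singleton_self α, ?_⟩
  · obtain ⟨β, rfl⟩ := Ideal.mem_span_singleton'.1 hτ
    exact ⟨β, by rw [Subring.coe_mul, map_intCast_mul_rat_aux, Matrix.mul_nonsing_inv_cancel_right _ _ hαu]⟩
  · rw [Finset.sum_const, Finset.card_univ, Fintype.card_fin, one_smul, Matrix.nonsing_inv_mul _ hαu]

variable {Φ}

/-- **An invertible ideal contains an isogeny `[d]`, `d ∈ ℤ ∖ 0`** (so it is a lattice in `End(X)`, Kieffer's
standing convention "we assume that `I` is also a lattice in `End(A)` … equivalent to requiring that `I`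
contains an isogeny"): clearing the denominators of the `x_k`, `d = Σ_k (d x_k) σ_k ∈ I`.
[cite: Kieffer2024IsogenyGraphs, §1.4.1 (after Def. 1.4.2) and §1.4.3 (sketch of proof of Theorem 2), pp. 43, 47] -/
theorem IsInvertibleIdeal.exists_intCast_mem {I : Ideal (endRingInt Φ)} (hI : IsInvertibleIdeal Φ I) :
    ∃ d : ℤ, d ≠ 0 ∧ (d : endRingInt Φ) ∈ I := by
  obtain ⟨n, x, σ, hx, -, hσ, hsum⟩ := hI
  obtain ⟨d, hd, hA⟩ := exists_intMatrix_map_eq_zsmul_family x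
  choose A hA using hA
  have hAend : ∀ k, A k ∈ endRingInt Φ := fun k ↦ by
    rw [mem_endRingInt_iff, hA]
    exact (endAlgRat Φ).toSubmodule.smul_of_tower_mem d (hx k)
  refine ⟨d, hd, ?_⟩
  have heq : (d : endRingInt Φ) = ∑ k, (⟨A k, hAend k⟩ : endRingInt Φ) * σ k := by
    apply Subtype.ext
    apply Matrix.map_injective (Int.cast_injective (α := ℚ))
    change ((d : endRingInt Φ) : Matrix ι ι ℤ).map (Int.cast : ℤ → ℚ) =
      ((∑ k, (⟨A k, hAend k⟩ : endRingInt Φ) * σ k : endRingInt Φ) : Matrix ι ι ℤ).map (Int.cast : ℤ → ℚ)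
    rw [coe_sum_mul_map_aux, SubringClass.coe_intCast, Matrix.map_intCast Int.cast_zero,
      ← Matrix.smul_one_eq_diagonal]
    calc (Int.cast d : ℚ) • (1 : Matrix ι ι ℚ) = (d : ℚ) • ∑ k, x k * (σ k : Matrix ι ι ℤ).map (Int.cast : ℤ → ℚ) := by
          rw [hsum]
      _ = ∑ k, (A k).map (Int.cast : ℤ → ℚ) * (σ k : Matrix ι ι ℤ).map (Int.cast : ℤ → ℚ) := by
          rw [Finset.smul_sum]
          exact Finset.sum_congr rfl fun k _ ↦ by rw [hA, ← Int.cast_smul_eq_zsmul ℚ, smul_mul_assoc]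
  rw [heq]
  exact I.sum_mem fun k _ ↦ I.mul_mem_left _ (hσ k)

/-- **`H(I)` is finite for an invertible ideal** (`H(I) ⊆ X[d]` for the isogeny `[d] ∈ I`).
[cite: Kieffer2024IsogenyGraphs, §1.4.1 (after Def. 1.4.2: "`H(I)` is finite, because …") and §1.4.3, pp. 43, 47] -/
theorem IsInvertibleIdeal.finite_kernelSubgroup {I : Ideal (endRingInt Φ)} (hI : IsInvertibleIdeal Φ I) :
    Finite (kernelSubgroup Φ I) := by
  obtain ⟨d, hd, hdI⟩ := hI.exists_intCast_mem
  refine finite_kernelSubgroup_of_mem Φ hdI ?_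
  rw [SubringClass.coe_intCast, ← Int.smul_one_eq_cast, Matrix.det_smul, Matrix.det_one, mul_one]
  exact pow_ne_zero _ hd

end Invertible

/-! ## §2 Invertible ideals are kernel ideals -/

section KernelIdeal

variable {Φ}

/-- **Invertible ideals are kernel ideals** (the hypothesis under which the sketch applies Props. 1.4.6 (2) and
1.4.7 to `I`).  GLOBAL lattice proof: each `x_k` (`I x_k ⊆ End(X)`) maps `Λ = π⁻¹(0)` into
`Λ_I = π⁻¹H(I) = {y : τ_ℝ y ∈ ℤ^ι ∀ τ ∈ I}` (`τ x_k ∈ End(X)` preserves `Λ`); hence for `σ ∈ I(H(I))` the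
matrix `σ x_k` is `(r_k)_ℚ` with `r_k ∈ End(X)` (`exists_mem_idealOfSubgroup_coe_eq_mul`), and
`σ = σ · 1 = Σ_k (σ x_k) σ_k = Σ_k r_k σ_k ∈ I`.  So `I(H(I)) ⊆ I`, i.e. `I` is a kernel ideal.
[cite: Kieffer2024IsogenyGraphs, §1.4.3 (sketch of proof of Theorem 2: "Let `I` be an invertible ideal in `R`. By Proposition 1.4.7 … by Proposition 1.4.6 …", both stated for kernel ideals) with §1.4.1 Def. 1.4.2, pp. 43, 47] -/
theorem IsInvertibleIdeal.isKernelIdeal {I : Ideal (endRingInt Φ)} (hI : IsInvertibleIdeal Φ I) :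
    IsKernelIdeal Φ I := by
  obtain ⟨n, x, σ, hx, hxI, hσ, hsum⟩ := hI
  refine (isKernelIdeal_iff_le Φ).2 fun τ hτ ↦ ?_
  -- each `x_k` maps `Λ = π⁻¹(0)` into `Λ_I = π⁻¹ H(I)`
  have hK : ∀ k, ∀ y : ι → ℝ, proj Φ y ∈ (⊥ : AddSubgroup (ComplexTorus Φ)) →
      proj Φ ((x k).map (Rat.cast : ℚ → ℝ) *ᵥ y) ∈ kernelSubgroup Φ I := by
    intro k y hy
    obtain ⟨m, rfl⟩ := (proj_eq_zero_iff Φ).1 ((AddSubgroup.mem_bot).1 hy)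
    refine (proj_mem_kernelSubgroup_iff Φ I _).2 fun υ hυ ↦ ?_
    obtain ⟨r, hr⟩ := hxI k υ hυ
    refine ⟨(r : Matrix ι ι ℤ) *ᵥ m, ?_⟩
    rw [Matrix.mulVec_mulVec, ← map_intCast_map_ratCast_aux (υ : Matrix ι ι ℤ), ← map_ratCast_mul_aux, ← hr,
      map_intCast_map_ratCast_aux, intVec_mulVec]
  -- so `τ x_k = r_k ∈ End(X)` for `τ ∈ I(H(I))`
  choose r hr using fun k ↦ exists_mem_idealOfSubgroup_coe_eq_mul Φ (hx k) (hK k) hτ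
  -- and `τ = τ · 1 = Σ_k (τ x_k) σ_k = Σ_k r_k σ_k ∈ I`
  have hτeq : (τ : Matrix ι ι ℤ).map (Int.cast : ℤ → ℚ) =
      ((∑ k, r k * σ k : endRingInt Φ) : Matrix ι ι ℤ).map (Int.cast : ℤ → ℚ) := by
    calc (τ : Matrix ι ι ℤ).map (Int.cast : ℤ → ℚ)
        = (τ : Matrix ι ι ℤ).map (Int.cast : ℤ → ℚ) * ∑ k, x k * (σ k : Matrix ι ι ℤ).map (Int.cast : ℤ → ℚ) := by
          rw [hsum, Matrix.mul_one]
      _ = ∑ k, (r k : Matrix ι ι ℤ).map (Int.cast : ℤ → ℚ) * (σ k : Matrix ι ι ℤ).map (Int.cast : ℤ → ℚ) := by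
          rw [Finset.mul_sum]
          exact Finset.sum_congr rfl fun k _ ↦ by rw [(hr k).2, Matrix.mul_assoc]
      _ = _ := (coe_sum_mul_map_aux Φ Finset.univ r σ).symm
  rw [Subtype.ext (Matrix.map_injective (Int.cast_injective (α := ℚ)) hτeq)]
  exact I.sum_mem fun k _ ↦ I.mul_mem_left (r k) (hσ k)

end KernelIdeal

/-! ## §3 The endomorphism ring of `X/H(I)` is still `End(X)` -/

section EndomorphismRing

variable {Φ}

/-- **`O_r(I) = End(X)` for an invertible ideal of a commutative `End⁰(X)`.**  `⊇`: every `α ∈ End(X)`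
commutes with `I`, so `Iα = αI ⊆ I` (`map_intCast_mem_rightOrder_of_comm`).  `⊆`: if `M ∈ O_r(I)`, then
`σ_k M = τ_k ∈ I` and `τ_k x_k = r_k ∈ End(X)`, so `M = (Σ_k x_k σ_k) M = Σ_k x_k τ_k = Σ_k τ_k x_k = Σ_k r_k`
is integral. [cite: Kieffer2024IsogenyGraphs, §1.4.3 (sketch of proof of Theorem 2: "By Proposition 1.4.7, the endomorphism ring of `A/H(I)` is still `R`") with §1.4.1 Prop. 1.4.7, pp. 45–47] -/
theorem IsInvertibleIdeal.rightOrder_eq {I : Ideal (endRingInt Φ)} (hI : IsInvertibleIdeal Φ I)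
    (hcomm : ∀ M ∈ endAlgRat Φ, ∀ N ∈ endAlgRat Φ, M * N = N * M) :
    rightOrder Φ I = (endRingInt Φ).map (Int.castRingHom ℚ).mapMatrix := by
  obtain ⟨n, x, σ, hx, hxI, hσ, hsum⟩ := hI
  refine le_antisymm (fun M hM ↦ ?_) fun M hM ↦ ?_
  · obtain ⟨hMend, hM'⟩ := (mem_rightOrder_iff Φ).1 hM
    choose τ hτ using fun k ↦ hM' (σ k) (hσ k)
    choose r hr using fun k ↦ hxI k (τ k) (hτ k).1
    refine Subring.mem_map.2 ⟨((∑ k, r k : endRingInt Φ) : Matrix ι ι ℤ), (∑ k, r k).2, ?_⟩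
    change ((∑ k, r k : endRingInt Φ) : Matrix ι ι ℤ).map (Int.cast : ℤ → ℚ) = M
    rw [AddSubmonoidClass.coe_finsetSum, map_intCast_sum_aux]
    calc ∑ k, (r k : Matrix ι ι ℤ).map (Int.cast : ℤ → ℚ)
        = ∑ k, x k * ((σ k : Matrix ι ι ℤ).map (Int.cast : ℤ → ℚ) * M) :=
          Finset.sum_congr rfl fun k _ ↦ by
            rw [hr k, ← (hτ k).2]
            exact hcomm _ ((mem_endRingInt_iff Φ).1 (τ k).2) _ (hx k)
      _ = M := by
          simp_rw [← Matrix.mul_assoc]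
          rw [← Finset.sum_mul, hsum, Matrix.one_mul]
  · obtain ⟨A, hA, rfl⟩ := Subring.mem_map.1 hM
    change ((⟨A, hA⟩ : endRingInt Φ) : Matrix ι ι ℤ).map (Int.cast : ℤ → ℚ) ∈ rightOrder Φ I
    exact map_intCast_mem_rightOrder_of_comm Φ fun σ' _ ↦ mul_comm_of_endAlgRat_comm Φ hcomm σ' ⟨A, hA⟩

/-- Membership in `End(X)_ℚ = End(X) ⊗ 1 ⊆ M_ι(ℚ)`, the image of `End(X) ⊆ M_ι(ℤ)`.
[cite: Kieffer2024IsogenyGraphs, §1.4.3 (sketch of proof of Theorem 2: "we can identify endomorphism rings of all abelian varieties isogenous to `A` as subrings of `End⁰(A)`"), p. 47] -/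
theorem mem_map_endRingInt_iff {M : Matrix ι ι ℚ} :
    M ∈ (endRingInt Φ).map (Int.castRingHom ℚ).mapMatrix ↔
      ∃ α : endRingInt Φ, (α : Matrix ι ι ℤ).map (Int.cast : ℤ → ℚ) = M := by
  rw [Subring.mem_map]
  constructor
  · rintro ⟨A, hA, rfl⟩
    exact ⟨⟨A, hA⟩, rfl⟩
  · rintro ⟨α, rfl⟩
    exact ⟨α, α.2, rfl⟩

/-- **"By Proposition 1.4.7, the endomorphism ring of `A/H(I)` is still `R`"**: for an invertible ideal `I` of a
commutative `End⁰(X)`, `η(End(X/H(I))) = O_r(I) = End(X)_ℚ` inside `End⁰(X)`.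
[cite: Kieffer2024IsogenyGraphs, §1.4.3 (sketch of proof of Theorem 2) with §1.4.1 Prop. 1.4.7, pp. 45–47] -/
theorem IsInvertibleIdeal.range_quotientEndHom_eq {I : Ideal (endRingInt Φ)} (hI : IsInvertibleIdeal Φ I)
    (hcomm : ∀ M ∈ endAlgRat Φ, ∀ N ∈ endAlgRat Φ, M * N = N * M) [Finite (kernelSubgroup Φ I)] :
    (quotientEndHom Φ (kernelSubgroup Φ I)).range = (endRingInt Φ).map (Int.castRingHom ℚ).mapMatrix := by
  rw [hI.isKernelIdeal.range_quotientEndHom_eq Φ, hI.rightOrder_eq hcomm]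

/-- Elementwise: `η(γ) ∈ End(X)_ℚ` for every `γ ∈ End(X/H(I))`, and every `α ∈ End(X)` is `η(γ)` for a unique
`γ`. [cite: Kieffer2024IsogenyGraphs, §1.4.3 (sketch of proof of Theorem 2) with §1.4.1 Prop. 1.4.7, pp. 45–47] -/
theorem IsInvertibleIdeal.exists_quotientEndHom_eq_iff {I : Ideal (endRingInt Φ)} (hI : IsInvertibleIdeal Φ I)
    (hcomm : ∀ M ∈ endAlgRat Φ, ∀ N ∈ endAlgRat Φ, M * N = N * M) [Finite (kernelSubgroup Φ I)]
    {M : Matrix ι ι ℚ} :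
    (∃ γ : endRingInt (quotientByPeriod Φ (kernelSubgroup Φ I)), quotientEndHom Φ (kernelSubgroup Φ I) γ = M) ↔
      ∃ α : endRingInt Φ, (α : Matrix ι ι ℤ).map (Int.cast : ℤ → ℚ) = M := by
  rw [← mem_map_endRingInt_iff, ← hI.range_quotientEndHom_eq hcomm, RingHom.mem_range]

/-- **`End(X/H(I)) ≅ End(X)`** as rings (through `η` and `End(X) ≅ End(X)_ℚ`), for an invertible ideal of a
commutative `End⁰(X)`. [cite: Kieffer2024IsogenyGraphs, §1.4.3 (sketch of proof of Theorem 2: "the endomorphism ring of `A/H(I)` is still `R`"), p. 47] -/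
def IsInvertibleIdeal.quotientEndEquiv {I : Ideal (endRingInt Φ)} (hI : IsInvertibleIdeal Φ I)
    (hcomm : ∀ M ∈ endAlgRat Φ, ∀ N ∈ endAlgRat Φ, M * N = N * M) [Finite (kernelSubgroup Φ I)] :
    endRingInt (quotientByPeriod Φ (kernelSubgroup Φ I)) ≃+* endRingInt Φ :=
  (hI.isKernelIdeal.quotientEndEquivRightOrder Φ).trans
    ((RingEquiv.subringCongr (hI.rightOrder_eq hcomm)).trans
      ((endRingInt Φ).equivMapOfInjective _ fun _ _ h ↦
        Matrix.map_injective (Int.cast_injective (α := ℚ)) h).symm)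

/-- The isomorphism is `η` on matrices: `(quotientEndEquiv γ)_ℚ = η(γ)`.
[cite: Kieffer2024IsogenyGraphs, §1.4.3 (sketch of proof of Theorem 2), p. 47] -/
theorem IsInvertibleIdeal.coe_quotientEndEquiv {I : Ideal (endRingInt Φ)} (hI : IsInvertibleIdeal Φ I)
    (hcomm : ∀ M ∈ endAlgRat Φ, ∀ N ∈ endAlgRat Φ, M * N = N * M) [Finite (kernelSubgroup Φ I)]
    (γ : endRingInt (quotientByPeriod Φ (kernelSubgroup Φ I))) :
    ((hI.quotientEndEquiv hcomm γ : endRingInt Φ) : Matrix ι ι ℤ).map (Int.cast : ℤ → ℚ) =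
      quotientEndHom Φ (kernelSubgroup Φ I) γ := by
  have h := (endRingInt Φ).coe_equivMapOfInjective_apply (Int.castRingHom ℚ).mapMatrix
    (fun _ _ h ↦ Matrix.map_injective (Int.cast_injective (α := ℚ)) h) (hI.quotientEndEquiv hcomm γ)
  rw [IsInvertibleIdeal.quotientEndEquiv, RingEquiv.trans_apply, RingEquiv.trans_apply,
    RingEquiv.apply_symm_apply] at h
  exact h.symm

end EndomorphismRing

/-! ## §4 `X/H(I)` depends only on the class of `I`, and `X/H(I) ≅ X ⟺ I` is principal -/

section Classes

variable {Φ}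

/-- **"by Proposition 1.4.6, `A/H(I)` (up to isomorphism) does not depend on the class of `I` in the class
group"** — and conversely, since invertible ideals are kernel ideals: for invertible `I`, `J`,
`X/H(I) ≅ X/H(J) ⟺ I ~ J`. [cite: Kieffer2024IsogenyGraphs, §1.4.3 (sketch of proof of Theorem 2) with §1.4.1 Prop. 1.4.6, pp. 45, 47] -/
theorem IsInvertibleIdeal.isIsomorphic_quotient_iff_idealEquiv {I J : Ideal (endRingInt Φ)}
    (hI : IsInvertibleIdeal Φ I) (hJ : IsInvertibleIdeal Φ J)
    [Finite (kernelSubgroup Φ I)] [Finite (kernelSubgroup Φ J)] :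
    IsIsomorphic (quotientByPeriod Φ (kernelSubgroup Φ I)) (quotientByPeriod Φ (kernelSubgroup Φ J)) ↔
      IdealEquiv Φ I J :=
  (hI.isKernelIdeal.idealEquiv_iff_isIsomorphic hJ.isKernelIdeal).symm

/-- `X ≅ X/H(End(X))` (`H(End(X)) = H(End(X)·1) = 0`). [cite: Kieffer2024IsogenyGraphs, §1.4.1 ("if `I` is principal, then `A/H(I)` is isomorphic to `A`"), p. 45] -/
theorem isIsomorphic_quotientBy_kernelSubgroup_top [Finite (kernelSubgroup Φ (⊤ : Ideal (endRingInt Φ)))] :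
    IsIsomorphic (quotientByPeriod Φ (kernelSubgroup Φ (⊤ : Ideal (endRingInt Φ)))) Φ := by
  have h1 : IsIsogeny Φ Φ ((1 : endRingInt Φ) : Matrix ι ι ℤ) := by
    rw [OneMemClass.coe_one]
    exact isIsogeny_one Φ
  have htop : (⊤ : Ideal (endRingInt Φ)) = Ideal.span {(1 : endRingInt Φ)} := (Ideal.span_singleton_one).symm
  haveI : Finite (kernelSubgroup Φ (Ideal.span {(1 : endRingInt Φ)})) := by
    rw [← htop]
    infer_instance
  exact (isIsomorphic_quotientByPeriod_of_eq Φ (congrArg (kernelSubgroup Φ) htop)).trans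
    (isIsomorphic_quotientBy_kernelSubgroup_span_singleton h1)

/-- **"`A/H(I) ≃ A` if and only if `I` lies in the trivial class"**: for an invertible ideal `I`,
`X/H(I) ≅ X ⟺ I = End(X)α` for an isogeny `α` (`⟺ I ~ End(X)`, `idealEquiv_top_iff`).
[cite: Kieffer2024IsogenyGraphs, §1.4.3 (sketch of proof of Theorem 2) with §1.4.1 Prop. 1.4.6, pp. 45, 47] -/
theorem IsInvertibleIdeal.isIsomorphic_quotient_self_iff {I : Ideal (endRingInt Φ)} (hI : IsInvertibleIdeal Φ I)
    [Finite (kernelSubgroup Φ I)] :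
    IsIsomorphic (quotientByPeriod Φ (kernelSubgroup Φ I)) Φ ↔
      ∃ α : endRingInt Φ, (α : Matrix ι ι ℤ).det ≠ 0 ∧ I = Ideal.span {α} := by
  haveI : Finite (kernelSubgroup Φ (⊤ : Ideal (endRingInt Φ))) := by
    rw [kernelSubgroup_top]
    infer_instance
  have htop : IsKernelIdeal Φ (⊤ : Ideal (endRingInt Φ)) := (isKernelIdeal_iff_le Φ).2 le_top
  rw [← idealEquiv_top_iff Φ, hI.isKernelIdeal.idealEquiv_iff_isIsomorphic htop]
  exact ⟨fun h ↦ h.trans (isIsomorphic_quotientBy_kernelSubgroup_top).symm,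
    fun h ↦ h.trans isIsomorphic_quotientBy_kernelSubgroup_top⟩

/-- The trivial class acts trivially: `X/H(End(X)α) ≅ X` for an isogeny `α`.
[cite: Kieffer2024IsogenyGraphs, §1.4.3 (sketch of proof of Theorem 2) and §1.4.1, pp. 45, 47] -/
theorem IsInvertibleIdeal.isIsomorphic_quotient_self_of_eq_span {I : Ideal (endRingInt Φ)}
    (hI : IsInvertibleIdeal Φ I) [Finite (kernelSubgroup Φ I)] {α : endRingInt Φ}
    (hα : (α : Matrix ι ι ℤ).det ≠ 0) (h : I = Ideal.span {α}) :
    IsIsomorphic (quotientByPeriod Φ (kernelSubgroup Φ I)) Φ :=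
  hI.isIsomorphic_quotient_self_iff.2 ⟨α, hα, h⟩

end Classes

end ComplexTorus

end Literature.Geometry.Kaehler
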